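import Summits.BirchSwinnertonDyer.Rank1Residual.O5.HeegnerLogTransportThreeGoodSelmer
import Summits.BirchSwinnertonDyer.Rank1Residual.O5.HeegnerLogTransportThreeTameTamagawa
import HarnessLib

/-!
# O5 KL3 part 11b — KL3-B `O5BaseSelmerCountThree` is a THEOREM modulo Poitou–Tate duality, the local Euler
# characteristic and Kolyvagin's theorem (cell `b2b-bsdres`, lane CLASS-CLOSURE, class O5; seat o5-r2 GEN 21)

HONEST FRAMING (cell `b2b-bsdres`, run/shared/lean/b2b/bsd-rank1-residual/, verbatim in every file): the goal
of the cell is to DELETE the COMBINATION-SHAPED residual classes of the Birch–Swinnerton-Dyer formula for ALL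
analytic-rank `≤ 1` elliptic curves over `ℚ` — "full BSD formula for every rank `≤ 1` curve in class `C`"
assembled STRICTLY from published theorems — so that the rank-`≤ 1` remainder becomes exactly the
CONSTRUCTION-SHAPED classes, which are TYPED (missing-input `Prop`s), NOT attempted. This is not "finishing
BSD". Lane CLASS-CLOSURE: research routes; no claim beyond the stated classes; nothing is booked here; no mark
of `RESIDUAL-MAP.md` moves; census numbers are EVIDENCE. THEOREMS ONLY (no definition, no named fact, no
conjecture node; net named-fact debt `0`); no node file is touched; O5 stays OPEN; the restamp of the node
KL3-B (THEOREM-CANDIDATE ↦ THEOREM modulo the three displayed facts) is the typers' pen.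

## What this file does

* **`o5BaseSelmerCountThree_of_facts`** — the typed node KL3-B `O5BaseSelmerCountThree` of
  `O5/HeegnerLogTransportThree.lean` §2b (the Poitou–Tate COUNT of Castella's base Selmer group
  `Sel_𝔭(K, W[3^∞])` at an ADDITIVE (t′) `3`: `#Sel = 3^a`, `a = ord₃ #Ш(W/K)[3^∞] + 2 (ord₃ log_ω P − ord₃ [W(K):ℤP])`,
  "NOT in print at an additive prime") HOLDS, granted three facts displayed as hypotheses: Poitou–Tate duality
  for Selmer structures (`poitouTate_selmerStructure_duality`, Milne *ADT* I.4.10), the local Euler–Poincaré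
  characteristic (`localEulerPoincareCharacteristic`, Milne *ADT* I.2.8) — the two inputs of part 10a's exact
  count — and Kolyvagin's theorem (`kolyvagin`, Gross 1991 Thm. 1.3: a Heegner point of infinite order gives
  `rank W(K) = 1` and `Ш(W/K)` finite). Assembly: part 10b §3 `selmerAcBase_eq_pow_of_addv` (the count with
  `3 ∤ c₃(W)`, `rank = 1`, `Ш` finite displayed) + part 11a `not_three_dvd_localTamagawaNumber_three_of_condExpTwo`
  (`3 ∤ c₃` from `Addv W 3 ∧ f₃ = 2`) + Kolyvagin at the Heegner datum of the statement. The scope hypotheses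
  `0 ≤ ord₃ j` and "`ρ̄_{W,3}` onto" of KL3-B are not used.
* `selmerAcBase_card_eq_one_of_units_of_facts` — part 1's consumed direction
  (`selmerAcBase_card_eq_one_of_units`) with `h : O5BaseSelmerCountThree` discharged.

NET for the KL3 chain (memo `HOME/b2b-bsdres-o5-r2/gen21/O5-GEN21.md` §3, addendum): the typed base-Selmer
nodes KL3-B (this file) and KL3-G (part 10b) are BOTH theorems modulo textbook / printed facts; the END
theorems (part 9) are unchanged — their remaining typed input is KL3-A (`KrizLiUnitBitTransportThree`, print:
Kriz–Li Thm. 1.16 / Rem. 1.17). O5 OPEN; nothing booked; census = EVIDENCE.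

References: [JetchevSkinnerWan2017] Prop. 3.2.1, (7.1.5) (arXiv:1512.06894 pp. 10–11, 16); [Castella2018]
Def. 2.2 (arXiv:1704.06608 p. 5); [MilneADT2006] I.2.8, I.4.10; [Gross1991] Thm. 1.3; [Kolyvagin1990] Thm. A;
[SilvermanATAEC1994] IV.9.2, 9.4, Table 4.1; cell files `O5/HeegnerLogTransportThree.lean` (part 1, KL3-B),
`O5/HeegnerLogTransportThreeGoodSelmer.lean` (part 10b), `O5/HeegnerLogTransportThreeTameTamagawa.lean` (part 11a).

## TYPER PLACEMENT NOTE

Imports part 10b `O5/HeegnerLogTransportThreeGoodSelmer.lean` and part 11a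
`O5/HeegnerLogTransportThreeTameTamagawa.lean` (o5-r2 GEN 21; place both first) and nothing else outside the
tree. THEOREMS only, namespace `Summit.BirchSwinnertonDyer.Rank1Residual.O5.HeegnerLogTransport`; no `def`.
Checked jointly with parts 10a/10b/11a (scratch concatenation, `lean check` rc 0, 0 sorries, 0 warnings;
axioms `propext`, `Classical.choice`, `Quot.sound`) (o5-r2 GEN 21). Target path
`O5/HeegnerLogTransportThreeBaseSelmerCount.lean`.

## TYPER PLACEMENT NOTE (cc-typer-5 GEN 18 = O5 §3.5 / O6 §3.4 typer of record; by-name ask A-O5-G21-1b of o5-r2 GEN 21, HOME/INBOX.md l.13997: 'place by sha')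

Source: `HOME/b2b-bsdres-o5-r2/gen21/lean/HeegnerLogTransportThreeBaseSelmerCount.lean` sha16 `ab9c3944eb175b00` (126 l.; `gen21/SHA16.txt`; o5-r2's `lean check` rc 0 / 0 warnings / axioms std), re-hashed by the typer
right before writing; THIS file = KL3 part 11b = the source VERBATIM + this paragraph (imports, module text, every declaration block byte-identical; script
`class-closure/typer-5/gen18/g21b_place.py`); the typer's own farm check (this file over the tree, or jointly with its not-yet-built predecessor) rc 0 / 0 warnings, axioms std;
DEDUP `lean search --decl` on the new names: no match.  CONTENT LABELS (source, unchanged): THEOREMS ONLY — 0 `def`, 0 `@[conjecture]`, 0 Literature facts (net named-fact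
debt 0), no `sorry`; published inputs stay displayed hypotheses BY NAME.  KL3 parts in the tree: 1–3 p340741 / p341262 / p341640, Global p342632, OrdCompanion p343587 +
p344465, OrdSelmer p345030 + p345686, OrdTwist p346273, Residual Engine / Residual / End p347366 / p348865 / p350277, BaseSelmer p349318, ExactCount p349954, GoodSelmer p350559,
Literature index lemma p344022, Literature Kriz–Li Thm 1.16 fact p350088 (lit, A314).  HONEST FRAMING (cell `b2b-bsdres`): research route, lane CLASS-CLOSURE §3.5 O5; nothing asserted
beyond the displayed binders, nothing booked, no mark of `RESIDUAL-MAP.md` moves; census = EVIDENCE, never a Literature fact; O5 OPEN.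
-/

set_option autoImplicit false

noncomputable section

open scoped Classical

open WeierstrassCurve NumberField IsDedekindDomain Field
open Literature.NumberTheory.EllipticCurves Literature.NumberTheory.EllipticCurves.GreenbergSelmer
  Literature.NumberTheory.EllipticCurves.ModularForms
  Literature.NumberTheory.EllipticCurves.Rank1Residual
  Literature.NumberTheory.EllipticCurves.Rank1Residual.Typed
  Literature.NumberTheory.GaloisRepresentations Literature.NumberTheory.GaloisCohomology

namespace Summit.BirchSwinnertonDyer.Rank1Residual.O5.HeegnerLogTransport

open Summit.BirchSwinnertonDyer.Rank1Residual.X11b (padicLogOrd embAt)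
open Summit.BirchSwinnertonDyer.Rank1Residual.X11b.AcSelmer (selmerAcBase)

/-! ## §1 KL3-B PROVED modulo the three displayed facts -/

/-- **KL3-B `O5BaseSelmerCountThree` is a THEOREM modulo Poitou–Tate duality for Selmer structures, the local
Euler–Poincaré characteristic and Kolyvagin's theorem** (all three tree named facts, displayed as hypotheses;
nothing booked): part 10b §3 at the Heegner datum of the statement, with `3 ∤ c₃(W)` from part 11a
(`Addv W 3 ∧ f₃ = 2 ⇒` Kodaira `III`, `III*` or `Iₙ*`, `c₃ ∣ 2, 4`) and `rank W(K) = 1`, `Ш(W/K)` finite from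
Kolyvagin at the non-torsion Heegner point `P`.
[cite: JetchevSkinnerWan2017, Prop. 3.2.1 and (7.1.5) (arXiv:1512.06894 pp. 10–11, 16)]
[cite: MilneADT2006, Ch. I, Thm. 4.10 and Thm. 2.8] [cite: Gross1991, Thm. 1.3]
[cite: SilvermanATAEC1994, IV.9 Cor. 9.2, 9.4 and Table 4.1 (PDF pp. 340–346, 365)] -/
theorem o5BaseSelmerCountThree_of_facts
    (hPT : ∀ (K : Type) [Field K] [NumberField K], poitouTate_selmerStructure_duality K)
    (hEP : ∀ (K : Type) [Field K] [NumberField K] (v : HeightOneSpectrum (𝓞 K)),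
      localEulerPoincareCharacteristic (v.adicCompletion K))
    (hKo : ∀ (N : ℕ) [NeZero N] (W : WeierstrassCurve ℚ) (K : Type) [Field K] [NumberField K],
      kolyvagin N W K) :
    O5BaseSelmerCountThree := by
  intro W _ _ hadd _hj hf₂ _hs ht N _ D K _ _ hK hH _hd H ι P hP hP' 𝔭 h𝔭 he hf
  have hc3 : ¬ 3 ∣ (W.baseChange ℚ_[3]).localTamagawaNumber ℤ_[3] :=
    not_three_dvd_localTamagawaNumber_three_of_condExpTwo W hadd hf₂
  obtain ⟨hrank, hSha⟩ := hKo N W K hK hH ⟨D, H, ι, hP⟩ hP'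
  obtain ⟨hfin, a, hcard, ha⟩ := selmerAcBase_eq_pow_of_addv W hadd hc3 ht K hK (hPT K) (hEP K)
    hrank hSha P hP' 𝔭 h𝔭 he hf
  exact ⟨a, ⟨hfin, hcard⟩, ha⟩

/-- **Part 1's consumed direction with KL3-B DISCHARGED**: at an O5 Heegner datum with `Ш(W/K)[3^∞]` trivial and
`ord₃ log_ω P = ord₃ [W(K):ℤP]`, Castella's base Selmer group `Sel_𝔭(K, W[3^∞])` is trivial — modulo the
three displayed facts instead of the typed node. [cite: JetchevSkinnerWan2017, Prop. 3.2.1 and (7.1.5) (arXiv:1512.06894 pp. 10–11, 16)]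
[cite: MilneADT2006, Ch. I, Thm. 4.10 and Thm. 2.8] [cite: Gross1991, Thm. 1.3] -/
theorem selmerAcBase_card_eq_one_of_units_of_facts
    (hPT : ∀ (K : Type) [Field K] [NumberField K], poitouTate_selmerStructure_duality K)
    (hEP : ∀ (K : Type) [Field K] [NumberField K] (v : HeightOneSpectrum (𝓞 K)),
      localEulerPoincareCharacteristic (v.adicCompletion K))
    (hKo : ∀ (N : ℕ) [NeZero N] (W : WeierstrassCurve ℚ) (K : Type) [Field K] [NumberField K],
      kolyvagin N W K)
    (W : WeierstrassCurve ℚ) [W.IsElliptic] [W.IsGloballyMinimal]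
    (hA : Addv W 3) (hj : 0 ≤ padicValRat 3 W.j) (hf₂ : Additive.CondExpTwo W 3)
    (hs : W.HasSurjectiveModNGaloisRep 3) (ht : NoLocalThreeTorsionAt W 3)
    {N : ℕ} [NeZero N] (D : ModularParametrizationData W N) (K : Type) [Field K] [NumberField K]
    (hK : IsImaginaryQuadratic K) (hH : SatisfiesHeegnerHypothesis N K) (hd : NumberField.discr K < -4)
    (H : HeegnerDatum N (NumberField.discr K)) (ι : K →+* ℂ) (P : (W.baseChange K).toAffine.Point)
    (hP : WeierstrassCurve.Affine.Point.map ι.toRatAlgHom P = heegnerPointComplex D H)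
    (hP' : ¬ IsOfFinAddOrder P)
    (𝔭 : HeightOneSpectrum (𝓞 K)) (h𝔭 : ((3 : ℕ) : 𝓞 K) ∈ 𝔭.asIdeal)
    (he : 𝔭.asIdeal.ramificationIdx (𝓞 ℚ) = 1) (hf : 𝔭.asIdeal.inertiaDeg (𝓞 ℚ) = 1)
    (hSha : Nat.card (AddCommGroup.primaryComponent (W.baseChange K).sha 3) = 1)
    (hlog : padicLogOrd W 3 (embAt K 3 𝔭 h𝔭 he hf) P = padicValNat 3 (AddSubgroup.zmultiples P).index) :
    Nat.card (selmerAcBase (W.baseChange K) 3 𝔭 ∅) = 1 :=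
  selmerAcBase_card_eq_one_of_units (o5BaseSelmerCountThree_of_facts hPT hEP hKo) W hA hj hf₂ hs ht D K
    hK hH hd H ι P hP hP' 𝔭 h𝔭 he hf hSha hlog

end Summit.BirchSwinnertonDyer.Rank1Residual.O5.HeegnerLogTransport

end
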